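import Literature.NumberTheory.LFunctions.NymanBeurlingBaezDuarteProofs
import HarnessLib

/-!
# RH-EQUIVALENT·SPLITTING CENSUS (nb, neg) · V39 «TARGETS» (refuted branch): the top fifth `𝟙_(4/5,1]` is NOT Nyman–Beurling approximable — an RH-free refutation with an explicit Cauchy–Schwarz witness; compare: the top half `𝟙_(1/2,1]` is approximable iff RH; nothing here bears on the truth of RH

LABEL (line 1): RH-EQUIVALENT·SPLITTING (cell `rh-split`, seat (nb, neg), generation 14, census
candidate V39, branch (α) of the target axis).  On the cell `(1/2,1]` every dilate `{1/(kx)}`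
equals `1/(kx) - [k = 1]`, so every element of the closed real span of the dilates is `λ/x + c`
there (Báez-Duarte's space `D`, Balazard arXiv:1812.04309 §1): a target that is not of this shape
on the cell is at POSITIVE `L²`-distance from the span, whatever the truth of RH.

* `fract_one_div_succ_mul_of_mem_cell` : `{1/((k+1)x)} = 1/((k+1)x) - [k = 0]` for `1/2 < x ≤ 1`.
* `not_nbTarget_Ioc_four_fifths` : TARGET(`𝟙_(4/5,1]`) is FALSE: the test function
  `w = 5·𝟙_(64/125,16/25] - 9·𝟙_(16/25,4/5] + 4·𝟙_(4/5,1]` is orthogonal to `1/x` and to `1` on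
  the cell (the three intervals have the common ratio `5/4`, so `∫ w/x = (5-9+4)log(5/4) = 0`, and
  `∫ w = 5·16/125 - 9·4/25 + 4/5 = 0`), while `⟨w, 𝟙_(4/5,1]⟩ = 4/5`; Cauchy–Schwarz then bounds the
  distance from below by `(4/5)/‖w‖₂ > 0`.

Hygiene: zero `def`s, no `sorry`, no new axioms, no `instance`/`notation`.
-/

set_option linter.dupNamespace false

noncomputable section

open Filter MeasureTheory Set
open scoped Real Topology ENNReal

namespace Summit.RiemannHypothesis.RiemannHypothesis.Theorems.Splittings.NbTargets

/-- On the cell `1/2 < x ≤ 1`: `{1/((k+1)x)} = 1/((k+1)x) - [k = 0]` (the floor is `1` for `k = 0`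
and `0` for `k ≥ 1`). [folklore; Balazard2020, §1 (the space `D`)] -/
theorem fract_one_div_succ_mul_of_mem_cell {x : ℝ} (hx : 1 / 2 < x) (hx1 : x ≤ 1) (k : ℕ) :
    Int.fract (1 / (((k : ℕ) + 1 : ℝ) * x)) =
      1 / (((k : ℕ) + 1 : ℝ) * x) - if k = 0 then 1 else 0 := by
  have hx0 : 0 < x := by linarith
  rcases Nat.eq_zero_or_pos k with rfl | hk
  · simp only [Nat.cast_zero, zero_add, one_mul, if_true]
    have h1 : (1 : ℝ) ≤ 1 / x := by rw [le_div_iff₀ hx0]; linarith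
    have h2 : 1 / x < 2 := by rw [div_lt_iff₀ hx0]; linarith
    have hfl : ⌊1 / x⌋ = 1 := Int.floor_eq_iff.2 ⟨by exact_mod_cast h1, by push_cast; linarith⟩
    rw [← Int.self_sub_floor, hfl]
    push_cast
    ring
  · rw [if_neg hk.ne', sub_zero]
    have hk1 : (1 : ℝ) ≤ k := by exact_mod_cast hk
    apply Int.fract_eq_self.2 ⟨by positivity, ?_⟩
    rw [div_lt_one (by positivity)]
    nlinarith

/-- `∫_{(0,∞)} 𝟙_(a,b](x) g(x) dx = ∫_a^b g` for `0 ≤ a ≤ b`. [folklore] -/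
theorem integral_Ioi_indicator_one_mul {a b : ℝ} (ha : 0 ≤ a) (hab : a ≤ b) (g : ℝ → ℝ) :
    ∫ x in Ioi (0 : ℝ), (Ioc a b).indicator 1 x * g x = ∫ x in a..b, g x := by
  have hfun : (fun x ↦ (Ioc a b).indicator (1 : ℝ → ℝ) x * g x) = (Ioc a b).indicator g := by
    funext x
    by_cases hx : x ∈ Ioc a b
    · rw [indicator_of_mem hx, indicator_of_mem hx, Pi.one_apply, one_mul]
    · rw [indicator_of_notMem hx, indicator_of_notMem hx, zero_mul]
  have hsub : Ioi (0 : ℝ) ∩ Ioc a b = Ioc a b :=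
    inter_eq_right.2 fun x hx ↦ ha.trans_lt hx.1
  rw [hfun, setIntegral_indicator measurableSet_Ioc, hsub, intervalIntegral.integral_of_le hab]

/-- `x ↦ 𝟙_(a,b](x) g(x)` is integrable on `(0,∞)` when `g` is continuous on `[a,b]`. [folklore] -/
theorem integrable_indicator_one_mul {a b : ℝ} {g : ℝ → ℝ} (hg : ContinuousOn g (Icc a b)) :
    Integrable (fun x ↦ (Ioc a b).indicator 1 x * g x) (volume.restrict (Ioi (0 : ℝ))) := by
  have hfun : (fun x ↦ (Ioc a b).indicator (1 : ℝ → ℝ) x * g x) = (Ioc a b).indicator g := by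
    funext x
    by_cases hx : x ∈ Ioc a b
    · rw [indicator_of_mem hx, indicator_of_mem hx, Pi.one_apply, one_mul]
    · rw [indicator_of_notMem hx, indicator_of_notMem hx, zero_mul]
  rw [hfun]
  refine IntegrableOn.integrable_indicator ?_ measurableSet_Ioc
  exact ((hg.integrableOn_Icc).mono_set Ioc_subset_Icc_self).mono_measure Measure.restrict_le_self

/-- **THE TOP FIFTH IS NOT A NYMAN–BEURLING TARGET (RH-free refutation).**  The indicator
`𝟙_(4/5,1]` is NOT an `L²(0,∞)`-limit of real combinations `∑_{k<N} c_k{1/((k+1)x)}`.  Witness: the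
step function `w = 5·𝟙_(64/125,16/25] - 9·𝟙_(16/25,4/5] + 4·𝟙_(4/5,1]` satisfies `∫ w/x = 0`
(three intervals of common ratio `5/4`), `∫ w = 0`, hence `⟨w, ∑ c_k{1/((k+1)x)}⟩ = 0` for all real
`c` (on `(1/2,1]` the sum is `C/x - c_0`), while `⟨w, 𝟙_(4/5,1]⟩ = 4/5`; by Cauchy–Schwarz every
approximant is at distance `≥ (4/5)/‖w‖₂` from the target.  Contrast: `𝟙_(1/2,1]` (a full cell) IS
approximable iff RH (`nbTarget_cell_iff`, `m = 1`).  Census reading: targets outside Báez-Duarte's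
space `D` are refuted conjuncts — door-less for a splitting of RH.
[cite: Balazard2020, §1 and Prop. 10 (i); BaezDuarte2003, Thm. 1.1] -/
theorem not_nbTarget_Ioc_four_fifths :
    ¬ ∀ ε : ℝ, 0 < ε → ∃ (N : ℕ) (c : Fin N → ℝ),
      eLpNorm (fun x : ℝ ↦ (Ioc (4 / 5 : ℝ) 1).indicator 1 x -
          ∑ k : Fin N, c k * Int.fract (1 / (((k : ℕ) + 1 : ℝ) * x))) 2
        (volume.restrict (Ioi 0)) < ENNReal.ofReal ε := by
  intro h
  -- the three indicator functions and the test function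
  set I₁ : ℝ → ℝ := (Ioc (64 / 125 : ℝ) (16 / 25)).indicator 1 with hI₁
  set I₂ : ℝ → ℝ := (Ioc (16 / 25 : ℝ) (4 / 5)).indicator 1 with hI₂
  set I₃ : ℝ → ℝ := (Ioc (4 / 5 : ℝ) 1).indicator 1 with hI₃
  set w : ℝ → ℝ := fun x ↦ 5 * I₁ x - 9 * I₂ x + 4 * I₃ x with hw
  have hIm : ∀ {a b : ℝ}, Measurable ((Ioc a b).indicator (1 : ℝ → ℝ)) :=
    fun {a b} ↦ measurable_one.indicator measurableSet_Ioc
  have hwm : Measurable w := by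
    refine ((hIm.const_mul _).sub (hIm.const_mul _)).add (hIm.const_mul _)
  have hImem : ∀ {a b : ℝ}, MemLp ((Ioc a b).indicator (1 : ℝ → ℝ)) 2 (volume.restrict (Ioi (0 : ℝ))) := by
    intro a b
    have hfin : (volume.restrict (Ioi (0 : ℝ))) (Ioc a b) ≠ ⊤ := by
      rw [Measure.restrict_apply measurableSet_Ioc]
      exact ((measure_mono inter_subset_left).trans_lt measure_Ioc_lt_top).ne
    exact memLp_indicator_const 2 measurableSet_Ioc (1 : ℝ) (Or.inr hfin)
  have hwL2 : MemLp w 2 (volume.restrict (Ioi (0 : ℝ))) := ((hImem.const_mul 5).sub (hImem.const_mul 9)).add (hImem.const_mul 4)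
  set K : ℝ := (eLpNorm w 2 (volume.restrict (Ioi (0 : ℝ)))).toReal with hK
  have hK0 : 0 ≤ K := ENNReal.toReal_nonneg
  ------------------------------------------------------------------
  -- (1) the three moments of `w`: `∫ w/x = 0`, `∫ w = 0`, `∫ w·𝟙_(4/5,1] = 4/5`
  ------------------------------------------------------------------
  have hinv : ∀ {a b : ℝ}, 0 < a → a ≤ b →
      Integrable (fun x ↦ (Ioc a b).indicator (1 : ℝ → ℝ) x * x⁻¹) (volume.restrict (Ioi (0 : ℝ))) ∧
        ∫ x in Ioi (0 : ℝ), (Ioc a b).indicator (1 : ℝ → ℝ) x * x⁻¹ = Real.log (b / a) := by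
    intro a b ha hab
    refine ⟨integrable_indicator_one_mul
      ((continuousOn_inv₀).mono fun x hx ↦ (ha.trans_le hx.1).ne'), ?_⟩
    rw [integral_Ioi_indicator_one_mul ha.le hab, integral_inv_of_pos ha (ha.trans_le hab)]
  have hone : ∀ {a b : ℝ}, 0 ≤ a → a ≤ b →
      Integrable (fun x ↦ (Ioc a b).indicator (1 : ℝ → ℝ) x * 1) (volume.restrict (Ioi (0 : ℝ))) ∧
        ∫ x in Ioi (0 : ℝ), (Ioc a b).indicator (1 : ℝ → ℝ) x * 1 = b - a := by
    intro a b ha hab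
    refine ⟨integrable_indicator_one_mul continuousOn_const, ?_⟩
    rw [integral_Ioi_indicator_one_mul ha hab, intervalIntegral.integral_const, smul_eq_mul, mul_one]
  obtain ⟨hi1, hv1⟩ := hinv (a := 64 / 125) (b := 16 / 25) (by norm_num) (by norm_num)
  obtain ⟨hi2, hv2⟩ := hinv (a := 16 / 25) (b := 4 / 5) (by norm_num) (by norm_num)
  obtain ⟨hi3, hv3⟩ := hinv (a := 4 / 5) (b := 1) (by norm_num) (by norm_num)
  obtain ⟨hj1, hu1⟩ := hone (a := 64 / 125) (b := 16 / 25) (by norm_num) (by norm_num)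
  obtain ⟨hj2, hu2⟩ := hone (a := 16 / 25) (b := 4 / 5) (by norm_num) (by norm_num)
  obtain ⟨hj3, hu3⟩ := hone (a := 4 / 5) (b := 1) (by norm_num) (by norm_num)
  have hW1 : ∫ x in Ioi (0 : ℝ), w x * x⁻¹ = 0 := by
    have : (fun x ↦ w x * x⁻¹) = fun x ↦
        5 * (I₁ x * x⁻¹) - 9 * (I₂ x * x⁻¹) + 4 * (I₃ x * x⁻¹) := by
      funext x; simp only [hw]; ring
    rw [this, integral_add ((hi1.const_mul 5).sub' (hi2.const_mul 9)) (hi3.const_mul 4),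
      integral_sub (hi1.const_mul 5) (hi2.const_mul 9), integral_const_mul, integral_const_mul,
      integral_const_mul, hv1, hv2, hv3]
    norm_num
    ring
  have hW2 : ∫ x in Ioi (0 : ℝ), w x = 0 := by
    have : w = fun x ↦ 5 * (I₁ x * 1) - 9 * (I₂ x * 1) + 4 * (I₃ x * 1) := by
      funext x; simp only [hw]; ring
    rw [this, integral_add ((hj1.const_mul 5).sub' (hj2.const_mul 9)) (hj3.const_mul 4),
      integral_sub (hj1.const_mul 5) (hj2.const_mul 9), integral_const_mul, integral_const_mul,
      integral_const_mul, hu1, hu2, hu3]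
    norm_num
  have hW3 : ∫ x in Ioi (0 : ℝ), w x * I₃ x = 4 / 5 := by
    have : (fun x ↦ w x * I₃ x) = fun x ↦ 4 * (I₃ x * 1) := by
      funext x
      simp only [hw, hI₁, hI₂, hI₃]
      by_cases h3 : x ∈ Ioc (4 / 5 : ℝ) 1
      · have h1 : x ∉ Ioc (64 / 125 : ℝ) (16 / 25) := fun h' ↦ by
          linarith [h'.2, h3.1]
        have h2 : x ∉ Ioc (16 / 25 : ℝ) (4 / 5) := fun h' ↦ by
          linarith [h'.2, h3.1]
        simp only [indicator_of_mem h3, indicator_of_notMem h1, indicator_of_notMem h2,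
          Pi.one_apply]
        ring
      · simp only [indicator_of_notMem h3, mul_zero, zero_mul]
    rw [this, integral_const_mul, hu3]
    norm_num
  ------------------------------------------------------------------
  -- (2) for every approximant: `∫ w · (target - approximant) = 4/5`
  ------------------------------------------------------------------
  have pair : ∀ (N : ℕ) (c : Fin N → ℝ), ∫ x in Ioi (0 : ℝ), w x *
      (I₃ x - ∑ k : Fin N, c k * Int.fract (1 / (((k : ℕ) + 1 : ℝ) * x))) = 4 / 5 := by
    intro N c
    set C : ℝ := ∑ k : Fin N, c k / ((k : ℕ) + 1) with hC
    set c₀ : ℝ := ∑ k : Fin N, if (k : ℕ) = 0 then c k else 0 with hc₀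
    -- pointwise: `w · (I₃ - S) = w·I₃ - C (w/x) + c₀ w`
    have hpt : ∀ x : ℝ, w x * (I₃ x - ∑ k : Fin N, c k * Int.fract (1 / (((k : ℕ) + 1 : ℝ) * x))) =
        w x * I₃ x - C * (w x * x⁻¹) + c₀ * w x := by
      intro x
      by_cases hx : 1 / 2 < x ∧ x ≤ 1
      · have hS : ∑ k : Fin N, c k * Int.fract (1 / (((k : ℕ) + 1 : ℝ) * x)) = C * x⁻¹ - c₀ := by
          rw [hC, hc₀, Finset.sum_mul, ← Finset.sum_sub_distrib]
          refine Finset.sum_congr rfl fun k _ ↦ ?_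
          rw [fract_one_div_succ_mul_of_mem_cell hx.1 hx.2]
          have hx0 : x ≠ 0 := by linarith [hx.1]
          have hk0 : ((k : ℕ) : ℝ) + 1 ≠ 0 := by positivity
          split_ifs
          · field_simp
          · field_simp
            ring
        rw [hS]; ring
      · -- outside the cell `(1/2,1]` the test function vanishes
        have hx' : x ∉ Ioc (64 / 125 : ℝ) (16 / 25) ∧ x ∉ Ioc (16 / 25 : ℝ) (4 / 5) ∧
            x ∉ Ioc (4 / 5 : ℝ) 1 := by
          refine ⟨fun h' ↦ hx ⟨by linarith [h'.1], by linarith [h'.2]⟩,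
            fun h' ↦ hx ⟨by linarith [h'.1], by linarith [h'.2]⟩,
            fun h' ↦ hx ⟨by linarith [h'.1], h'.2⟩⟩
        have hw0 : w x = 0 := by
          simp only [hw, hI₁, hI₂, hI₃, indicator_of_notMem hx'.1, indicator_of_notMem hx'.2.1,
            indicator_of_notMem hx'.2.2]
          ring
        simp only [hw0, zero_mul, mul_zero, sub_zero, add_zero]
    have hiW3 : Integrable (fun x ↦ w x * I₃ x) (volume.restrict (Ioi (0 : ℝ))) := by
      have : (fun x ↦ w x * I₃ x) = fun x ↦ 4 * (I₃ x * 1) := by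
        funext x
        simp only [hw, hI₁, hI₂, hI₃]
        by_cases h3 : x ∈ Ioc (4 / 5 : ℝ) 1
        · have h1 : x ∉ Ioc (64 / 125 : ℝ) (16 / 25) := fun h' ↦ by linarith [h'.2, h3.1]
          have h2 : x ∉ Ioc (16 / 25 : ℝ) (4 / 5) := fun h' ↦ by linarith [h'.2, h3.1]
          simp only [indicator_of_mem h3, indicator_of_notMem h1, indicator_of_notMem h2,
            Pi.one_apply]
          ring
        · simp only [indicator_of_notMem h3, mul_zero, zero_mul]
      rw [this]; exact hj3.const_mul 4
    have hiW1 : Integrable (fun x ↦ w x * x⁻¹) (volume.restrict (Ioi (0 : ℝ))) := by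
      have : (fun x ↦ w x * x⁻¹) = fun x ↦
          5 * (I₁ x * x⁻¹) - 9 * (I₂ x * x⁻¹) + 4 * (I₃ x * x⁻¹) := by
        funext x; simp only [hw]; ring
      rw [this]; exact ((hi1.const_mul 5).sub (hi2.const_mul 9)).add (hi3.const_mul 4)
    have hiW2 : Integrable w (volume.restrict (Ioi (0 : ℝ))) := by
      have : w = fun x ↦ 5 * (I₁ x * 1) - 9 * (I₂ x * 1) + 4 * (I₃ x * 1) := by
        funext x; simp only [hw]; ring
      rw [this]; exact ((hj1.const_mul 5).sub (hj2.const_mul 9)).add (hj3.const_mul 4)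
    simp_rw [hpt]
    rw [integral_add (hiW3.sub' (hiW1.const_mul C)) (hiW2.const_mul c₀),
      integral_sub hiW3 (hiW1.const_mul C), integral_const_mul, integral_const_mul, hW3, hW1, hW2]
    ring
  ------------------------------------------------------------------
  -- (3) Cauchy–Schwarz: `4/5 ≤ K ε` for every `ε > 0`, absurd
  ------------------------------------------------------------------
  have bound : ∀ ε : ℝ, 0 < ε → (4 / 5 : ℝ) ≤ K * ε := by
    intro ε hε
    obtain ⟨N, c, hN⟩ := h ε hε
    set E : ℝ → ℝ := fun x ↦ I₃ x -
      ∑ k : Fin N, c k * Int.fract (1 / (((k : ℕ) + 1 : ℝ) * x)) with hE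
    have hEm : Measurable E := by
      refine hIm.sub (Finset.measurable_sum _ fun k _ ↦ ?_)
      exact measurable_const.mul (measurable_fract.comp (by fun_prop))
    have hH : eLpNorm (w • E) 1 (volume.restrict (Ioi (0 : ℝ))) ≤ eLpNorm w 2 (volume.restrict (Ioi (0 : ℝ))) * eLpNorm E 2 (volume.restrict (Ioi (0 : ℝ))) :=
      eLpNorm_smul_le_mul_eLpNorm hEm.aestronglyMeasurable hwm.aestronglyMeasurable
    have hfin : eLpNorm w 2 (volume.restrict (Ioi (0 : ℝ))) * ENNReal.ofReal ε ≠ ⊤ :=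
      ENNReal.mul_ne_top hwL2.eLpNorm_lt_top.ne ENNReal.ofReal_ne_top
    calc (4 / 5 : ℝ) = ‖∫ x in Ioi (0 : ℝ), w x * E x‖ := by
          rw [hE]; simp only; rw [pair N c]; norm_num
      _ ≤ (∫⁻ x in Ioi (0 : ℝ), ENNReal.ofReal ‖w x * E x‖).toReal :=
          norm_integral_le_lintegral_norm _
      _ = (eLpNorm (w • E) 1 (volume.restrict (Ioi (0 : ℝ)))).toReal := by
          rw [eLpNorm_one_eq_lintegral_enorm]
          simp_rw [ofReal_norm]
          rfl
      _ ≤ (eLpNorm w 2 (volume.restrict (Ioi (0 : ℝ))) * ENNReal.ofReal ε).toReal :=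
          ENNReal.toReal_mono hfin (hH.trans (by gcongr))
      _ = K * ε := by rw [ENNReal.toReal_mul, ENNReal.toReal_ofReal hε.le]
  have hb := bound ((4 / 5) / (2 * (K + 1))) (by positivity)
  have : K * ((4 / 5) / (2 * (K + 1))) < 4 / 5 := by
    rw [mul_div_assoc', div_lt_iff₀ (by positivity)]
    nlinarith
  linarith

end Summit.RiemannHypothesis.RiemannHypothesis.Theorems.Splittings.NbTargets
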